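import Summits.HodgeConjecture.HodgeConjecture.Theorems.HeckePrymWeilWeilVariationalHodgeReductions
import Summits.HodgeConjecture.HodgeConjecture.Theorems.HeckePrymWeilWeilVariationalHodgeLowRungs
import Literature.AlgebraicGeometry.Motives.CurveThroughTwoPointsProofs

/-!
# Route HeckePrymWeil — `WeilVariationalHodge` (stmt-HodgeConjecture-14497): reduction to CURVE bases

The crux `HeckePrymWeil.WeilVariationalHodge` (Grothendieck's variational Hodge statement for
fibrewise-rational `(M,M)` global classes along smooth proper families of abelian `2M`-folds with
`√-p`-multiplication over smooth irreducible `ℂ`-schemes) is EQUIVALENT to its restriction to families over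
smooth irreducible AFFINE CURVES (`IsAffine C`, `Smooth (C ⟶ Spec ℂ)`, `topologicalKrullDim C = 1`), and —
with the landed low rung `M = 1` (Lefschetz `(1,1)`, `weilVariationalHodge_iff_two_le`, p140813) — to that
restriction with `M ≥ 2`. Unconditional: the one classical input, Mumford's lemma that two points of an
irreducible variety lie on a (smooth, after normalisation) irreducible curve, is a theorem of the tree
(`Motives.mumford_smoothCurve_through_two_points_holds`).

Proof of the reduction (`weilRung_affine_of_curve`): by `weilVariationalHodge_iff_affineRung` (p138458) the
base may be taken smooth irreducible affine; if the target point `s` is the anchor `s₀` there is nothing to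
prove; otherwise join `s₀` to `s` by a smooth irreducible affine curve `g : C ⟶ S` (Mumford), base-change the
family along `g` (`Motives.familyPullback`; again a smooth projective family), pull the class back, move the
fibrewise hypotheses, the Weil-fibre isomorphisms and the anchor across the identification of the fibres of
the base change with fibres of `f` (`familyPullback_fibrewise_rational_hodge`, `familyPullback_fibrewise_weil`,
`familyPullback_mem_algebraicClasses_iff`, p86972), apply the curve rung, and move the conclusion back.
(The analogous reduction for the general crux `AnchorTransport.VariationalHodge`, stmt-1076, is
`variationalHodge_of_curveBase`.)
-/

noncomputable section

-- every declaration of this problem lives in `Summit.HodgeConjecture.HodgeConjecture.…` (summit = sub-problem)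
set_option linter.dupNamespace false

open CategoryTheory AlgebraicGeometry TopologicalSpace
open Literature.AlgebraicGeometry.Motives Literature.AlgebraicGeometry.HodgeTheory
open Summit.HodgeConjecture.HodgeConjecture.Theses

namespace Summit.HodgeConjecture.HodgeConjecture.Theorems

/-- **Curve rung ⇒ affine rung.** If the Weil rung `(p, M)` holds for families over smooth irreducible affine
CURVES, it holds for families over smooth irreducible affine bases: join the anchor to the target point by a
smooth irreducible affine curve (`mumford_smoothCurve_through_two_points_holds`) and transport along the base
change. [cite: MumfordAV1970, §6, Lemma] -/
theorem weilRung_affine_of_curve {p M : ℕ}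
    (h : ∀ ⦃𝒳 C : SchemeOver ℂ⦄ (f : 𝒳 ⟶ C), IsSmoothProjectiveFamily f (2 * M) → IrreducibleSpace C.left →
      IsAffine C.left → AlgebraicGeometry.Smooth C.hom → topologicalKrullDim C.left = 1 →
      ∀ (W : complexBetti 𝒳 (2 * M)),
      (∀ s : ComplexPoints C, IsRationalClass (complexBetti.map (fiberι f s) (2 * M) W) ∧
        IsOfHodgeType (2 * M) (fiberOver f s) (2 * M) M M (complexBetti.map (fiberι f s) (2 * M) W)) →
      (∀ s : ComplexPoints C, ∃ (A' : AbelianVariety ℂ) (φ' : A' ⟶ A'), A'.dim = (2 * M) ∧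
        φ' ≫ φ' = -((p : ℤ) • 𝟙 A') ∧ Nonempty (A'.X ≅ fiberOver f s)) →
      (∃ s₀ : ComplexPoints C, complexBetti.map (fiberι f s₀) (2 * M) W ∈ algebraicClasses (fiberOver f s₀) M) →
      ∀ s : ComplexPoints C, complexBetti.map (fiberι f s) (2 * M) W ∈ algebraicClasses (fiberOver f s) M) :
    ∀ ⦃𝒳 S : SchemeOver ℂ⦄ (f : 𝒳 ⟶ S), IsSmoothProjectiveFamily f (2 * M) → IrreducibleSpace S.left →
      IsAffine S.left → AlgebraicGeometry.Smooth S.hom → ∀ (W : complexBetti 𝒳 (2 * M)),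
      (∀ s : ComplexPoints S, IsRationalClass (complexBetti.map (fiberι f s) (2 * M) W) ∧
        IsOfHodgeType (2 * M) (fiberOver f s) (2 * M) M M (complexBetti.map (fiberι f s) (2 * M) W)) →
      (∀ s : ComplexPoints S, ∃ (A' : AbelianVariety ℂ) (φ' : A' ⟶ A'), A'.dim = (2 * M) ∧
        φ' ≫ φ' = -((p : ℤ) • 𝟙 A') ∧ Nonempty (A'.X ≅ fiberOver f s)) →
      (∃ s₀ : ComplexPoints S, complexBetti.map (fiberι f s₀) (2 * M) W ∈ algebraicClasses (fiberOver f s₀) M) →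
      ∀ s : ComplexPoints S, complexBetti.map (fiberι f s) (2 * M) W ∈ algebraicClasses (fiberOver f s) M := by
  intro 𝒳 S f hf hirr haff hsm W hW hA hs₀ s
  obtain ⟨s₀, hs₀⟩ := hs₀
  by_cases hss : s₀ = s
  · exact hss ▸ hs₀
  haveI := hirr
  haveI := haff
  haveI := hsm
  -- a smooth irreducible affine curve through the anchor and the target point (Mumford)
  obtain ⟨C, g, a, b, hCaff, hCirr, hCsm, hCdim, ha, hb⟩ :=
    mumford_smoothCurve_through_two_points_holds.of_irreducibleSpace s₀ s hss
  -- base change along `g`, apply the curve rung, and come back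
  rw [← hb, ← familyPullback_mem_algebraicClasses_iff g hf M W b]
  refine h (familyPullback.snd f g) (hf.familyPullback_snd g) hCirr hCaff hCsm hCdim _
    (familyPullback_fibrewise_rational_hodge f g W hW) (familyPullback_fibrewise_weil f g hA) ⟨a, ?_⟩ b
  rw [familyPullback_mem_algebraicClasses_iff g hf M W a, ha]
  exact hs₀

/-- **The crux is equivalent to its restriction to smooth irreducible affine CURVE bases** (all `M ≥ 1`):
`→` by specialisation; `←` by the curve reduction `weilRung_affine_of_curve` followed by the affine reduction
(`weilVariationalHodge_iff_affineRung`). [cite: MumfordAV1970, §6, Lemma] -/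
theorem weilVariationalHodge_iff_curveRung :
    HeckePrymWeil.WeilVariationalHodge ↔
    ∀ p : ℕ, p.Prime → p % 4 = 3 → 7 ≤ p → ∀ M : ℕ, 1 ≤ M →
      ∀ ⦃𝒳 C : SchemeOver ℂ⦄ (f : 𝒳 ⟶ C), IsSmoothProjectiveFamily f (2 * M) → IrreducibleSpace C.left →
      IsAffine C.left → AlgebraicGeometry.Smooth C.hom → topologicalKrullDim C.left = 1 →
      ∀ (W : complexBetti 𝒳 (2 * M)),
      (∀ s : ComplexPoints C, IsRationalClass (complexBetti.map (fiberι f s) (2 * M) W) ∧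
        IsOfHodgeType (2 * M) (fiberOver f s) (2 * M) M M (complexBetti.map (fiberι f s) (2 * M) W)) →
      (∀ s : ComplexPoints C, ∃ (A' : AbelianVariety ℂ) (φ' : A' ⟶ A'), A'.dim = (2 * M) ∧
        φ' ≫ φ' = -((p : ℤ) • 𝟙 A') ∧ Nonempty (A'.X ≅ fiberOver f s)) →
      (∃ s₀ : ComplexPoints C, complexBetti.map (fiberι f s₀) (2 * M) W ∈ algebraicClasses (fiberOver f s₀) M) →
      ∀ s : ComplexPoints C, complexBetti.map (fiberι f s) (2 * M) W ∈ algebraicClasses (fiberOver f s) M := by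
  rw [weilVariationalHodge_iff_affineRung]
  exact ⟨fun hV p hp hp4 hp7 M hM _ _ f hf hirr haff hsm _ W hW hA hs₀ s =>
      hV p hp hp4 hp7 M hM f hf hirr haff hsm W hW hA hs₀ s,
    fun h p hp hp4 hp7 M hM => weilRung_affine_of_curve (h p hp hp4 hp7 M hM)⟩

/-- **The crux is equivalent to its restriction to smooth irreducible affine curve bases AND fibre dimension
`2M ≥ 4`**: the rung `M = 1` holds outright (Lefschetz `(1,1)` fibrewise, `weilVariationalHodge_iff_two_le`).
This is the sharpest unconditional normal form of stmt-HodgeConjecture-14497 in the tree: Grothendieck's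
variational Hodge statement for fibrewise-rational `(M,M)` classes, `M ≥ 2`, along smooth proper families of
abelian `2M`-folds with `√-p`-multiplication over smooth irreducible affine curves.
[cite: MumfordAV1970, §6, Lemma] [cite: VoisinHodgeI2002, Thm. 11.30] -/
theorem weilVariationalHodge_iff_curveRung_two_le :
    HeckePrymWeil.WeilVariationalHodge ↔
    ∀ p : ℕ, p.Prime → p % 4 = 3 → 7 ≤ p → ∀ M : ℕ, 2 ≤ M →
      ∀ ⦃𝒳 C : SchemeOver ℂ⦄ (f : 𝒳 ⟶ C), IsSmoothProjectiveFamily f (2 * M) → IrreducibleSpace C.left →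
      IsAffine C.left → AlgebraicGeometry.Smooth C.hom → topologicalKrullDim C.left = 1 →
      ∀ (W : complexBetti 𝒳 (2 * M)),
      (∀ s : ComplexPoints C, IsRationalClass (complexBetti.map (fiberι f s) (2 * M) W) ∧
        IsOfHodgeType (2 * M) (fiberOver f s) (2 * M) M M (complexBetti.map (fiberι f s) (2 * M) W)) →
      (∀ s : ComplexPoints C, ∃ (A' : AbelianVariety ℂ) (φ' : A' ⟶ A'), A'.dim = (2 * M) ∧
        φ' ≫ φ' = -((p : ℤ) • 𝟙 A') ∧ Nonempty (A'.X ≅ fiberOver f s)) →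
      (∃ s₀ : ComplexPoints C, complexBetti.map (fiberι f s₀) (2 * M) W ∈ algebraicClasses (fiberOver f s₀) M) →
      ∀ s : ComplexPoints C, complexBetti.map (fiberι f s) (2 * M) W ∈ algebraicClasses (fiberOver f s) M := by
  rw [weilVariationalHodge_iff_two_le]
  refine ⟨fun hV p hp hp4 hp7 M hM _ _ f hf hirr _ hsm _ W hW hA hs₀ s =>
      hV p hp hp4 hp7 M hM f hf hirr hsm W hW hA hs₀ s, fun h p hp hp4 hp7 M hM => ?_⟩
  exact stub_affineReduction p M (weilRung_affine_of_curve (h p hp hp4 hp7 M hM))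

end Summit.HodgeConjecture.HodgeConjecture.Theorems

end
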